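import Summits.BirchSwinnertonDyer.BirchSwinnertonDyer.Theorems.GenusKolyvaginAtTwoPowDvdShaCardAtTwoRTAuxiliaryClassDeepAllPlaces
import Summits.BirchSwinnertonDyer.BirchSwinnertonDyer.Theorems.GenusKolyvaginAtTwoPowDvdShaCardAtTwoRTAuxiliaryClassDeep
import HarnessLib

/-!
# Route `GenusKolyvaginAtTwo`, LINES 18/19 (L_T stmt-BirchSwinnertonDyer-23242, L⁺_T stmt-23379), step (b) input I5, deep form:
# THE LAGRANGIAN HYPOTHESIS FROM «ISOTROPY + HALF-SIZE COUNT» (the shape the suppliers of I7 produce)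

Width seat `bsd-line-gk2-p4` g16 (cell `bsd-f1-sign2`), `--supports stmt-BirchSwinnertonDyer-23242` (helper; closes nothing).
THEOREMS ONLY: no definition, no named fact, no `sorry`; standard axioms.  BSD is NOT proved by any of this.

WHY.  The deep auxiliary-class theorems (gk2-p3 g19 `exists_mem_kummerOutside_addOrderOf_dvd_sq`, totally complex `K`, finite
places; this seat's `exists_mem_kummerOutside_addOrderOf_dvd_sq_places` / `…_canonical`, any `K`, any places) take the local
conditions `H_v` on `S` as LAGRANGIANS `annLeft (inv_v(· ∪ₑ ·)) H_v = H_v`.  The suppliers deliver them differently: the transverse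
line at an own Kolyvagin prime comes as «cup products of two transverse classes vanish» (I7: gk2-p3 `…RTTransverseIsotropic(Values)`
over `ℚ_ℓ` / `K_λ`; `KolyvaginLowerBoundAtTwo.weilCupProduct_eq_zero_of_mem_transverseSubgroup_ringClassField_two` and its
`annRight_… = ` form on route `KolyvaginRankRigidityAtTwo`) plus the count `#H_v² = #H¹(K_v, E[2^L])`; gk2-p2 g16's small-depth
bottom rung (memo `Lines/plus-descent-step-b-prop52.md`, Addendum 4: auxiliary `ỹ ∈ H¹(ℚ, E[8])` over `ℚ`, free at `l₀`, transverse
lines on `S ∖ l₀`, strict Kummer everywhere else including `p ∣ d_K`, of order `≥ 2^{⌈L/2⌉}`) is exactly `…_eq_pow_canonical` at `K = ℚ`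
once the lines are known Lagrangian.  This file closes that gap by pure counting: ISOTROPIC + `#H² = #X` ⟹ LAGRANGIAN (and
`annRight = H ⟹ annLeft = H`), and restates the three deep theorems with «isotropy + count» hypotheses.

WHAT (namespace `…Theorems.GenusExact.AuxiliaryClass`):
* `annLeft_eq_of_isotropic_of_sq` — `b : X →+ X →+ ℤ/n` with bijective adjoint, `H` isotropic with `#H² = #X` ⟹ `annLeft b H = H`;
  `annLeft_eq_self_of_annRight_eq_self` — `annRight b H = H ⟹ annLeft b H = H` (perfect `b`).
* `exists_mem_kummerOutside_addOrderOf_dvd_sq_places_of_isotropic` (any `K`, any places, displayed family),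
  `exists_mem_kummerOutside_addOrderOf_eq_pow_canonical_of_isotropic` (UNCONDITIONAL, canonical family, `p`-power form),
  `exists_mem_kummerOutside_addOrderOf_eq_pow_canonical_of_lines` (prescribed self-orthogonal LINES `ℤ·t_v` of half size — the
  `ℚ_l`-shape of the transverse condition), `exists_mem_kummerOutside_addOrderOf_dvd_sq_of_isotropic` (gk2-p3's totally complex
  form), `…_of_isotropic_exact` / `…_of_lines_exact` (EXACT order `p^m` at the free place for `2m ≤ M`, by rescaling): hypotheses
  `hiso : ∀ v ∈ S, ∀ a a' ∈ H_v, inv_v(a ∪ₑ a') = 0` and `hHcard : ∀ v ∈ S, #H_v² = #H¹(K_v, E[p^k])` in place of the Lagrangian.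

References: [McCallumLMS1991] §2 Prop. 2.1, §5 proof of Prop. 5.2, Lemma 5.3; [MilneADT2006] Ch. I §0 (Prop. 0.19), Thm. 4.10;
[MazurRubin2004] Prop. 1.3.2 (ii).
-/

set_option autoImplicit false
-- the Theorems namespace of this sub repeats the summit name by design (D-0017 nested layout)
set_option linter.dupNamespace false

noncomputable section

open scoped Classical

open CategoryTheory Field NumberField IsDedekindDomain Function
open Literature.NumberTheory.EllipticCurves
open Literature.NumberTheory.GaloisRepresentations
open Literature.NumberTheory.GaloisCohomology
open Summit.BirchSwinnertonDyer.Rank1Residual.X11b.KummerPT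
open Summit.BirchSwinnertonDyer.Rank1Residual.X11b.FiniteDuality
open Summit.BirchSwinnertonDyer.Rank1Residual.X11b.Relaxation
open Summit.BirchSwinnertonDyer.Rank1Residual.X11b.LocBridge Summit.BirchSwinnertonDyer.Rank1Residual.X11b.Levels
open Summit.BirchSwinnertonDyer.Rank1Residual.X11b.AcSelmer
open scoped ContRepresentation

namespace Summit.BirchSwinnertonDyer.BirchSwinnertonDyer.Theorems.GenusExact.AuxiliaryClass

open Summit.BirchSwinnertonDyer.BirchSwinnertonDyer.Theorems.GenusKolyKramer (finite_galoisCohomology_toLocal)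

/-! ## §1 Isotropic + half-size ⟹ Lagrangian -/

section Algebra

variable {X : Type*} [AddCommGroup X] {n : ℕ}

/-- **An isotropic subgroup of half size is Lagrangian**: for a pairing `b : X → X → ℤ/n` on a finite group killed by `n` whose
(left) adjoint is bijective, `H` isotropic with `#H² = #X` ⟹ `annLeft b H = H` (`H ≤ {}^⊥H` and `#{}^⊥H · #H = #X`).
[cite: MilneADT2006, Ch. I, §0, Prop. 0.19] -/
theorem annLeft_eq_of_isotropic_of_sq [Finite X] [NeZero n] (hX : ∀ x : X, n • x = 0) (b : X →+ X →+ ZMod n)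
    (hb : Bijective b) (H : AddSubgroup X) (hiso : ∀ a ∈ H, ∀ a' ∈ H, b a a' = 0)
    (hcard : Nat.card H ^ 2 = Nat.card X) : annLeft b H = H := by
  have hle : H ≤ annLeft b H := fun a ha ↦ (mem_annLeft_iff b H a).mpr fun a' ha' ↦ hiso a ha a' ha'
  symm
  refine AddSubgroup.eq_of_le_of_card_ge hle (le_of_eq ?_)
  have h1 := natCard_annLeft_mul hX b hb H
  have hpos : 0 < Nat.card H := Nat.card_pos
  refine Nat.eq_of_mul_eq_mul_right hpos ?_
  rw [h1, ← hcard, sq]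

/-- **Right-Lagrangian ⟹ left-Lagrangian** for a perfect pairing (both adjoints bijective): `annRight b H = H ⟹ annLeft b H = H`
(double annihilator). [cite: MilneADT2006, Ch. I, §0, Prop. 0.19] -/
theorem annLeft_eq_self_of_annRight_eq_self [Finite X] [NeZero n] (hX : ∀ x : X, n • x = 0) (b : X →+ X →+ ZMod n)
    (hb : Bijective b) (hflip : Bijective b.flip) (H : AddSubgroup X) (h : annRight b H = H) : annLeft b H = H := by
  conv_lhs => rw [← h]
  exact annLeft_annRight hX hX b hb hflip H

/-- Conversely a Lagrangian is isotropic of half size. [cite: MilneADT2006, Ch. I, §0, Prop. 0.19] -/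
theorem isotropic_and_sq_of_annLeft_eq [Finite X] [NeZero n] (hX : ∀ x : X, n • x = 0) (b : X →+ X →+ ZMod n)
    (hb : Bijective b) (H : AddSubgroup X) (h : annLeft b H = H) :
    (∀ a ∈ H, ∀ a' ∈ H, b a a' = 0) ∧ Nat.card H ^ 2 = Nat.card X := by
  refine ⟨fun a ha a' ha' ↦ ?_, ?_⟩
  · rw [← h] at ha
    exact (mem_annLeft_iff b H a).mp ha a' ha'
  · have h1 := natCard_annLeft_mul hX b hb H
    rw [h] at h1
    rw [sq, h1]


/-- A cyclic subgroup generated by a SELF-ORTHOGONAL element is isotropic. [folklore] -/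
theorem isotropic_zmultiples_of_self_eq_zero (b : X →+ X →+ ZMod n) (t : X) (ht : b t t = 0) :
    ∀ a ∈ AddSubgroup.zmultiples t, ∀ a' ∈ AddSubgroup.zmultiples t, b a a' = 0 := by
  intro a ha a' ha'
  obtain ⟨m, rfl⟩ := AddSubgroup.mem_zmultiples_iff.mp ha
  obtain ⟨m', rfl⟩ := AddSubgroup.mem_zmultiples_iff.mp ha'
  rw [map_zsmul, map_zsmul, AddMonoidHom.zsmul_apply, ht, smul_zero, smul_zero]


/-- Rescaling to an EXACT prime-power order: `ord y = p^j`, `m ≤ j` ⟹ `ord(p^{j−m}·y) = p^m`. [folklore] -/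
theorem addOrderOf_pow_sub_nsmul_eq {Y : Type*} [AddCommGroup Y] {p : ℕ} (hp : p.Prime) {y : Y} {j m : ℕ}
    (hy : addOrderOf y = p ^ j) (hm : m ≤ j) : addOrderOf ((p ^ (j - m)) • y) = p ^ m := by
  have h := addOrderOf_nsmul_of_dvd (x := y) (n := p ^ (j - m)) (pow_ne_zero _ hp.ne_zero)
    (by rw [hy]; exact pow_dvd_pow p (Nat.sub_le j m))
  rw [h, hy, Nat.pow_div (Nat.sub_le j m) hp.pos]
  congr 1
  omega

end Algebra

/-! ## §2 The deep auxiliary class from isotropy + count -/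

section Deep

variable {K : Type} [Field K] [NumberField K] (W : WeierstrassCurve K) [W.IsElliptic]
variable (p k : ℕ) [Fact p.Prime] [Finite (W.geomTorsion ((p ^ k : ℕ) : ℤ))]
variable (e : W.geomTorsion ((p ^ k : ℕ) : ℤ) → W.geomTorsion ((p ^ k : ℕ) : ℤ) → AlgebraicClosure K)
  (hμ : ∀ S T, e S T ^ (p ^ k) = 1)
  (hadd₁ : ∀ S₁ S₂ T, e (S₁ + S₂) T = e S₁ T * e S₂ T)
  (hadd₂ : ∀ S T₁ T₂, e S (T₁ + T₂) = e S T₁ * e S T₂)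
  (hgal : ∀ (σ : absoluteGaloisGroup K) (S T : W.geomTorsion ((p ^ k : ℕ) : ℤ)),
    σ • e S T = e (σ • S) (σ • T))
  (halt : ∀ T, e T T = 1) (hnondeg : ∀ T, (∀ S, e S T = 1) → T = 0)

include halt hnondeg in
/-- **Deep Prop. 2.1 at any place of any number field, «isotropy + count» form**: as
`exists_mem_kummerOutside_addOrderOf_dvd_sq_places`, with `H_v` (`v ∈ S`) ISOTROPIC for `inv_v(· ∪ₑ ·)` and of half size
`#H_v² = #H¹(K_v, E[p^k])`. [cite: McCallumLMS1991, §2 Prop. 2.1 and §5 proof of Prop. 5.2] [cite: MilneADT2006, Ch. I, Thm. 4.10] -/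
theorem exists_mem_kummerOutside_addOrderOf_dvd_sq_places_of_isotropic
    {inv : LocalInvariants K (p ^ k)} (hperf : inv.IsPerfect) (hsum : inv.SumLocalTermEqZero)
    (hcompl : inv.SelmerComplement)
    (hEuler : ∀ v : HeightOneSpectrum (𝓞 K),
      Nat.card (galoisCohomology ((W.torsionGaloisModule ((p ^ k : ℕ) : ℤ)).toLocal (Sum.inr v)) 1) =
        (Nat.card (nsmulAddMonoidHom (p ^ k) :
            (W.baseChange (v.adicCompletion K)).toAffine.Point →+ _).ker *
          Nat.card (v.adicCompletionIntegers K ⧸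
            Ideal.span {((p ^ k : ℕ) : v.adicCompletionIntegers K)})) ^ 2)
    (hreal : ∀ w : InfinitePlace K, w.IsReal → Injective (inv (Sum.inl w)))
    (S : Finset (Place K)) (w : Place K) (hwS : w ∉ S)
    (H : ∀ v : Place K, AddSubgroup (galoisCohomology ((W.torsionGaloisModule ((p ^ k : ℕ) : ℤ)).toLocal v) 1))
    (hiso : ∀ v ∈ S, ∀ a ∈ H v, ∀ a' ∈ H v, invWeilPairing W (p ^ k) e hμ hadd₁ hadd₂ hgal inv v a a' = 0)
    (hHcard : ∀ v ∈ S, Nat.card (H v) ^ 2 =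
      Nat.card (galoisCohomology ((W.torsionGaloisModule ((p ^ k : ℕ) : ℤ)).toLocal v) 1))
    (x₀ : galoisCohomology ((W.torsionGaloisModule ((p ^ k : ℕ) : ℤ)).toLocal w) 1) :
    ∃ c ∈ kummerOutside W (p ^ k) (insert w S),
      (∀ v ∈ S, galoisCohomology.localization (W.torsionGaloisModule ((p ^ k : ℕ) : ℤ)) v 1 c ∈ H v) ∧
      addOrderOf x₀ ∣ addOrderOf (galoisCohomology.localization (W.torsionGaloisModule ((p ^ k : ℕ) : ℤ)) w 1 c) ^ 2 := by
  have hH : ∀ v ∈ S, annLeft (invWeilPairing W (p ^ k) e hμ hadd₁ hadd₂ hgal inv v) (H v) = H v := fun v hv ↦ by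
    haveI := finite_galoisCohomology_toLocal W (p ^ k) v
    exact annLeft_eq_of_isotropic_of_sq (fun x ↦ nsmul_galoisCohomology_toLocal_eq_zero W (p ^ k) _ x) _
      (invWeilPairing_bijective_place W (p ^ k) e hμ hadd₁ hadd₂ hgal halt hnondeg inv hperf hreal v) (H v) (hiso v hv)
      (hHcard v hv)
  exact exists_mem_kummerOutside_addOrderOf_dvd_sq_places W p k e hμ hadd₁ hadd₂ hgal halt hnondeg hperf hsum hcompl hEuler
    hreal S w hwS H hH x₀

omit [Finite (W.geomTorsion ((p ^ k : ℕ) : ℤ))] in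
include halt hnondeg in
/-- **Deep Prop. 2.1, canonical family, «isotropy + count» form, `p`-power conclusion — UNCONDITIONAL for every number field**
(e.g. `K = ℚ`: gk2-p2's small-depth auxiliary `ỹ` over `ℚ`, free at `l₀ = w`, in the transverse lines on `S`, strict Kummer at every
other place, `ord ≥ p^{⌈M/2⌉}` at `w`). [cite: McCallumLMS1991, §2 Prop. 2.1 and §5 proof of Prop. 5.2] -/
theorem exists_mem_kummerOutside_addOrderOf_eq_pow_canonical_of_isotropic (hk : 0 < k)
    (S : Finset (Place K)) (w : Place K) (hwS : w ∉ S)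
    (H : ∀ v : Place K, AddSubgroup (galoisCohomology ((W.torsionGaloisModule ((p ^ k : ℕ) : ℤ)).toLocal v) 1))
    (hiso : ∀ v ∈ S, ∀ a ∈ H v, ∀ a' ∈ H v, (haveI : Finite (W.geomTorsion ((p ^ k : ℕ) : ℤ)) := finite_geomTorsion_pow W p k
      invWeilPairing W (p ^ k) e hμ hadd₁ hadd₂ hgal (LocalInvariants.canonical K (p ^ k)) v) a a' = 0)
    (hHcard : ∀ v ∈ S, Nat.card (H v) ^ 2 =
      Nat.card (galoisCohomology ((W.torsionGaloisModule ((p ^ k : ℕ) : ℤ)).toLocal v) 1))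
    {x₀ : galoisCohomology ((W.torsionGaloisModule ((p ^ k : ℕ) : ℤ)).toLocal w) 1} {M : ℕ}
    (hx₀ : addOrderOf x₀ = p ^ M) :
    ∃ c ∈ kummerOutside W (p ^ k) (insert w S),
      (∀ v ∈ S, galoisCohomology.localization (W.torsionGaloisModule ((p ^ k : ℕ) : ℤ)) v 1 c ∈ H v) ∧
      ∃ j : ℕ, addOrderOf (galoisCohomology.localization (W.torsionGaloisModule ((p ^ k : ℕ) : ℤ)) w 1 c) = p ^ j ∧
        M ≤ 2 * j := by
  have hprime : p.Prime := Fact.out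
  haveI : Finite (W.geomTorsion ((p ^ k : ℕ) : ℤ)) := finite_geomTorsion_pow W p k
  have hperf := LocalInvariants.canonical_isPerfect (K := K) (n := p ^ k)
  have hreal : ∀ w' : InfinitePlace K, w'.IsReal →
      Injective (LocalInvariants.canonical K (p ^ k) (Sum.inl w')) := fun w' hw' ↦ by
    rw [LocalInvariants.canonical_inl]
    exact archimedeanInvariantMap_injective_of_isReal hw'
  have hH : ∀ v ∈ S, annLeft (invWeilPairing W (p ^ k) e hμ hadd₁ hadd₂ hgal (LocalInvariants.canonical K (p ^ k)) v) (H v) =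
      H v := fun v hv ↦ by
    haveI := finite_galoisCohomology_toLocal W (p ^ k) v
    exact annLeft_eq_of_isotropic_of_sq (fun x ↦ nsmul_galoisCohomology_toLocal_eq_zero W (p ^ k) _ x) _
      (invWeilPairing_bijective_place W (p ^ k) e hμ hadd₁ hadd₂ hgal halt hnondeg _ hperf hreal v) (H v) (hiso v hv)
      (hHcard v hv)
  exact exists_mem_kummerOutside_addOrderOf_eq_pow_canonical W p k e hμ hadd₁ hadd₂ hgal halt hnondeg hk S w hwS H hH hx₀

omit [Finite (W.geomTorsion ((p ^ k : ℕ) : ℤ))] in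
include halt hnondeg in
/-- **Deep Prop. 2.1, canonical family, «isotropy + count» form, EXACT order at the free place** (gk2-p2's «rescale to order exactly
`2^m`»): for `2m ≤ M` the class can be taken with `ord(loc_w c) = p^m` exactly (replace `c` by `p^{j−m}·c`; subgroups are stable).
[cite: McCallumLMS1991, §2 Prop. 2.1 and §5 proof of Prop. 5.2] -/
theorem exists_mem_kummerOutside_addOrderOf_eq_pow_canonical_of_isotropic_exact (hk : 0 < k)
    (S : Finset (Place K)) (w : Place K) (hwS : w ∉ S)
    (H : ∀ v : Place K, AddSubgroup (galoisCohomology ((W.torsionGaloisModule ((p ^ k : ℕ) : ℤ)).toLocal v) 1))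
    (hiso : ∀ v ∈ S, ∀ a ∈ H v, ∀ a' ∈ H v, (haveI : Finite (W.geomTorsion ((p ^ k : ℕ) : ℤ)) := finite_geomTorsion_pow W p k
      invWeilPairing W (p ^ k) e hμ hadd₁ hadd₂ hgal (LocalInvariants.canonical K (p ^ k)) v) a a' = 0)
    (hHcard : ∀ v ∈ S, Nat.card (H v) ^ 2 =
      Nat.card (galoisCohomology ((W.torsionGaloisModule ((p ^ k : ℕ) : ℤ)).toLocal v) 1))
    {x₀ : galoisCohomology ((W.torsionGaloisModule ((p ^ k : ℕ) : ℤ)).toLocal w) 1} {M : ℕ}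
    (hx₀ : addOrderOf x₀ = p ^ M) {m : ℕ} (hm : 2 * m ≤ M) :
    ∃ c ∈ kummerOutside W (p ^ k) (insert w S),
      (∀ v ∈ S, galoisCohomology.localization (W.torsionGaloisModule ((p ^ k : ℕ) : ℤ)) v 1 c ∈ H v) ∧
      addOrderOf (galoisCohomology.localization (W.torsionGaloisModule ((p ^ k : ℕ) : ℤ)) w 1 c) = p ^ m := by
  obtain ⟨c, hc, hcH, j, hj, hMj⟩ := exists_mem_kummerOutside_addOrderOf_eq_pow_canonical_of_isotropic W p k e hμ hadd₁ hadd₂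
    hgal halt hnondeg hk S w hwS H hiso hHcard hx₀
  refine ⟨(p ^ (j - m)) • c, AddSubgroup.nsmul_mem _ hc _, fun v hv ↦ ?_, ?_⟩
  · rw [map_nsmul]
    exact AddSubgroup.nsmul_mem _ (hcH v hv) _
  · rw [map_nsmul]
    exact addOrderOf_pow_sub_nsmul_eq (Fact.out : p.Prime) hj (by omega)

omit [Finite (W.geomTorsion ((p ^ k : ℕ) : ℤ))] in
include halt hnondeg in
/-- **Deep Prop. 2.1 through prescribed ISOTROPIC LINES — UNCONDITIONAL for every number field** (the `ℚ`-level shape: at an own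
Kolyvagin prime `l` of index `≥ k` the transverse condition in `H¹(ℚ_l, E[2^k]) ≅ (ℤ/2^k)²` is a cyclic line of order `2^k`): given at
each `v ∈ S` a self-orthogonal local class `t_v` (`canonical_v(t_v ∪ₑ t_v) = 0`) with `(ord t_v)² = #H¹(K_v, E[p^k])`, and `x₀` of order
`p^M` at the free place `w ∉ S`, there is `c`, Kummer off `S ∪ {w}`, with `loc_v c ∈ ℤ·t_v` on `S` and `ord(loc_w c) = p^j`, `M ≤ 2j`.
[cite: McCallumLMS1991, §2 Prop. 2.1 and §5 proof of Prop. 5.2, Lemma 5.3] -/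
theorem exists_mem_kummerOutside_addOrderOf_eq_pow_canonical_of_lines (hk : 0 < k)
    (S : Finset (Place K)) (w : Place K) (hwS : w ∉ S)
    (t : ∀ v : Place K, galoisCohomology ((W.torsionGaloisModule ((p ^ k : ℕ) : ℤ)).toLocal v) 1)
    (ht : ∀ v ∈ S, (haveI : Finite (W.geomTorsion ((p ^ k : ℕ) : ℤ)) := finite_geomTorsion_pow W p k
      invWeilPairing W (p ^ k) e hμ hadd₁ hadd₂ hgal (LocalInvariants.canonical K (p ^ k)) v) (t v) (t v) = 0)
    (htcard : ∀ v ∈ S, addOrderOf (t v) ^ 2 =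
      Nat.card (galoisCohomology ((W.torsionGaloisModule ((p ^ k : ℕ) : ℤ)).toLocal v) 1))
    {x₀ : galoisCohomology ((W.torsionGaloisModule ((p ^ k : ℕ) : ℤ)).toLocal w) 1} {M : ℕ}
    (hx₀ : addOrderOf x₀ = p ^ M) :
    ∃ c ∈ kummerOutside W (p ^ k) (insert w S),
      (∀ v ∈ S, galoisCohomology.localization (W.torsionGaloisModule ((p ^ k : ℕ) : ℤ)) v 1 c ∈
        AddSubgroup.zmultiples (t v)) ∧
      ∃ j : ℕ, addOrderOf (galoisCohomology.localization (W.torsionGaloisModule ((p ^ k : ℕ) : ℤ)) w 1 c) = p ^ j ∧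
        M ≤ 2 * j :=
  exists_mem_kummerOutside_addOrderOf_eq_pow_canonical_of_isotropic W p k e hμ hadd₁ hadd₂ hgal halt hnondeg hk S w hwS
    (fun v ↦ AddSubgroup.zmultiples (t v)) (fun v hv ↦ isotropic_zmultiples_of_self_eq_zero _ (t v) (ht v hv))
    (fun v hv ↦ by rw [Nat.card_zmultiples]; exact htcard v hv) hx₀

omit [Finite (W.geomTorsion ((p ^ k : ℕ) : ℤ))] in
include halt hnondeg in
/-- **Deep Prop. 2.1 through prescribed isotropic lines, EXACT order `p^m` at the free place** (`2m ≤ M`).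
[cite: McCallumLMS1991, §2 Prop. 2.1 and §5 proof of Prop. 5.2, Lemma 5.3] -/
theorem exists_mem_kummerOutside_addOrderOf_eq_pow_canonical_of_lines_exact (hk : 0 < k)
    (S : Finset (Place K)) (w : Place K) (hwS : w ∉ S)
    (t : ∀ v : Place K, galoisCohomology ((W.torsionGaloisModule ((p ^ k : ℕ) : ℤ)).toLocal v) 1)
    (ht : ∀ v ∈ S, (haveI : Finite (W.geomTorsion ((p ^ k : ℕ) : ℤ)) := finite_geomTorsion_pow W p k
      invWeilPairing W (p ^ k) e hμ hadd₁ hadd₂ hgal (LocalInvariants.canonical K (p ^ k)) v) (t v) (t v) = 0)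
    (htcard : ∀ v ∈ S, addOrderOf (t v) ^ 2 =
      Nat.card (galoisCohomology ((W.torsionGaloisModule ((p ^ k : ℕ) : ℤ)).toLocal v) 1))
    {x₀ : galoisCohomology ((W.torsionGaloisModule ((p ^ k : ℕ) : ℤ)).toLocal w) 1} {M : ℕ}
    (hx₀ : addOrderOf x₀ = p ^ M) {m : ℕ} (hm : 2 * m ≤ M) :
    ∃ c ∈ kummerOutside W (p ^ k) (insert w S),
      (∀ v ∈ S, galoisCohomology.localization (W.torsionGaloisModule ((p ^ k : ℕ) : ℤ)) v 1 c ∈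
        AddSubgroup.zmultiples (t v)) ∧
      addOrderOf (galoisCohomology.localization (W.torsionGaloisModule ((p ^ k : ℕ) : ℤ)) w 1 c) = p ^ m :=
  exists_mem_kummerOutside_addOrderOf_eq_pow_canonical_of_isotropic_exact W p k e hμ hadd₁ hadd₂ hgal halt hnondeg hk S w hwS
    (fun v ↦ AddSubgroup.zmultiples (t v)) (fun v hv ↦ isotropic_zmultiples_of_self_eq_zero _ (t v) (ht v hv))
    (fun v hv ↦ by rw [Nat.card_zmultiples]; exact htcard v hv) hx₀ hm

omit [Finite (W.geomTorsion ((p ^ k : ℕ) : ℤ))] in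
include halt hnondeg in
/-- **gk2-p3's deep Prop. 2.1 (totally complex `K`, finite places), «isotropy + count» form.**
[cite: McCallumLMS1991, §2 Prop. 2.1 and §5 proof of Prop. 5.2] [cite: MilneADT2006, Ch. I, Thm. 4.10] -/
theorem exists_mem_kummerOutside_addOrderOf_dvd_sq_of_isotropic (hK : ∀ w : InfinitePlace K, w.IsComplex)
    {inv : LocalInvariants K (p ^ k)} (hperf : inv.IsPerfect) (hsum : inv.SumLocalTermEqZero)
    (hcompl : inv.SelmerComplement)
    (hEuler : ∀ v : HeightOneSpectrum (𝓞 K),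
      Nat.card (galoisCohomology ((W.torsionGaloisModule ((p ^ k : ℕ) : ℤ)).toLocal (Sum.inr v)) 1) =
        (Nat.card (nsmulAddMonoidHom (p ^ k) :
            (W.baseChange (v.adicCompletion K)).toAffine.Point →+ _).ker *
          Nat.card (v.adicCompletionIntegers K ⧸
            Ideal.span {((p ^ k : ℕ) : v.adicCompletionIntegers K)})) ^ 2)
    (S : Finset (HeightOneSpectrum (𝓞 K))) (w : HeightOneSpectrum (𝓞 K)) (hwS : w ∉ S)
    (H : ∀ v : HeightOneSpectrum (𝓞 K),
      AddSubgroup (galoisCohomology ((W.torsionGaloisModule ((p ^ k : ℕ) : ℤ)).toLocal (Sum.inr v)) 1))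
    (hiso : ∀ v ∈ S, ∀ a ∈ H v, ∀ a' ∈ H v, invWeilPairing W (p ^ k) e hμ hadd₁ hadd₂ hgal inv (Sum.inr v) a a' = 0)
    (hHcard : ∀ v ∈ S, Nat.card (H v) ^ 2 =
      Nat.card (galoisCohomology ((W.torsionGaloisModule ((p ^ k : ℕ) : ℤ)).toLocal (Sum.inr v)) 1))
    (x₀ : galoisCohomology ((W.torsionGaloisModule ((p ^ k : ℕ) : ℤ)).toLocal (Sum.inr w)) 1) :
    ∃ c ∈ kummerOutside W (p ^ k) ((insert w S).map Function.Embedding.inr),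
      (∀ v ∈ S, galoisCohomology.localization (W.torsionGaloisModule ((p ^ k : ℕ) : ℤ)) (Sum.inr v) 1 c ∈ H v) ∧
      addOrderOf x₀ ∣
        addOrderOf (galoisCohomology.localization (W.torsionGaloisModule ((p ^ k : ℕ) : ℤ)) (Sum.inr w) 1 c) ^ 2 := by
  have hH : ∀ v ∈ S, annLeft (invWeilPairing W (p ^ k) e hμ hadd₁ hadd₂ hgal inv (Sum.inr v)) (H v) = H v := fun v hv ↦ by
    haveI := finite_galoisCohomology_toLocal_inr W (p ^ k) v
    exact annLeft_eq_of_isotropic_of_sq (fun x ↦ nsmul_galoisCohomology_toLocal_eq_zero W (p ^ k) _ x) _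
      (invWeilPairing_bijective W (p ^ k) e hμ hadd₁ hadd₂ hgal hnondeg inv v (hperf v).1.1) (H v) (hiso v hv) (hHcard v hv)
  exact exists_mem_kummerOutside_addOrderOf_dvd_sq W p k e hμ hadd₁ hadd₂ hgal halt hnondeg hK hperf hsum hcompl hEuler S w hwS
    H hH x₀

end Deep

end Summit.BirchSwinnertonDyer.BirchSwinnertonDyer.Theorems.GenusExact.AuxiliaryClass

end
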